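import Summits.CriticalPhenomena.SAWScalingLimit.Theorems.SAWDevelopingMapHexConjectureKPDefs
import Summits.CriticalPhenomena.SAWScalingLimit.Theorems.SAWDevelopingMapHexConjectureArchTailSummed
import Summits.CriticalPhenomena.SAWScalingLimit.Theorems.SAWDevelopingMapObservableToSLEHalfPlaneArchTightnessStrips
import Summits.CriticalPhenomena.SAWScalingLimit.Theorems.SAWDevelopingMapHexConjectureCodedReflect
import Mathlib.Analysis.Complex.Trigonometric
import Mathlib.Analysis.SpecialFunctions.Trigonometric.Basic
import Mathlib.Analysis.SpecificLimits.Basic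
import Mathlib.Algebra.Order.Interval.Finset.SuccPred
import HarnessLib

/-!
# Crux `HexConjecture` (stmt-CriticalPhenomena-0808), line `root-locality-replaces-loewner` (lead c12):
positivity of the half-plane boundary Gram form implies the Bochner tail inequality

Landing target:
`Summits/CriticalPhenomena/SAWScalingLimit/Theorems/SAWDevelopingMapHexConjectureBochnerIneqOfPositivity.lean`
(`--supports stmt-CriticalPhenomena-0808`; registered stub `stub_bochnerIneq_of_positivity`, s3's STUB 2).

With `G(k) := RootLocality.halfPlaneArch k` (Krachun–Panagiotis's half-plane boundary two-point function,
the supremum over the Duminil-Copin–Smirnov trapezoids `S_{N+1,N+1}` of the coded floor-arch mass at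
offset `k`), the registered hypothesis says that the Hermitian matrix `K_{jk} = 1 (j = k)`,
`e^{+5πi/8} G(k-j) (j < k)`, `e^{-5πi/8} G(j-k) (j > k)` is positive semi-definite; the conclusion is
`Σ_{1 ≤ k < M} G(k)·(cos((3π/8)(2k/M - 1)) - cos(3π/8)) ≤ (1 + cos(3π/8))·(1/(2cos(3π/8)) - Σ_{k=1}^{M} G(k))`.
Proof: test the form against the Fejér vector `c_j = e^{iqj}`, `j < n`, `q = 3π/(4M)` — its real part is
`n + 2·Σ_{1 ≤ m < n} (n - m)·G(m)·cos(qm + 5π/8)` (`BochnerIneq.gram_re`, counting lemma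
`BochnerIneq.sum_sum_kern`); use `-cos(qm + 5π/8) = cos((3π/8)(2m/M - 1))`, `cos ≤ 1`, `G ≥ 0` and the
flux bound `Σ_{1 ≤ k < n} G(k) ≤ 1/(2cos(3π/8))` (evenness `stub_codedArchSum_reflect` + `archTotal_le`,
passed to the supremum: `BochnerIneq.sum_halfPlaneArch_le`); divide by `n` and let `n → ∞` in the finite
sum over `m ≤ M` (`BochnerIneq.abstract_ineq`).  Sources: KrachunPanagiotis2026 (Definition 2.4),
DuminilCopinSmirnov2012 (Lemma 2, §3), GlazmanManolescu2019 (§4.1); the Bochner–Fejér step is folklore.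
-/

noncomputable section

open scoped BigOperators Topology
open Filter Set
open Literature.Probability.RandomPlanarGeometry.SAW Literature.Probability.RandomPlanarGeometry.SAW.HV
open Summit.CriticalPhenomena.SAWScalingLimit.Theorems.ObservableToSLE.FloorRatio (hvArchSum_mono)

namespace Summit.CriticalPhenomena.SAWScalingLimit.Theorems.HexConjecture.RootLocality

namespace BochnerIneq

/-! ### The boundary two-point function `G`: sign and flux bound -/

/-- `G ≥ 0`. [cite: KrachunPanagiotis2026, Definition 2.4 (G_k)] -/
theorem halfPlaneArch_nonneg (d : ℤ) : 0 ≤ halfPlaneArch d :=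
  Real.iSup_nonneg (codedArchSum_nonneg d)

/-- **Flux bound for `G`**: for every finite set `S` of positive offsets,
`Σ_{k ∈ S} G(k) ≤ 1/(2cos(3π/8))` — in a trapezoid containing `±S` on its floor,
`2·Σ_{k ∈ S} (coded sum at k) = Σ_{k ∈ S} (coded sums at k and at -k) ≤ A_{N+1,N+1} ≤ 1/cos(3π/8)`
(evenness, `archTotal_le`), and the coded sums increase to `G`.
[cite: DuminilCopinSmirnov2012, Lemma 2 and §3 ("A_T ≤ 1/c_α")] -/
theorem sum_halfPlaneArch_le (S : Finset ℕ) (hS : 0 ∉ S) :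
    ∑ k ∈ S, halfPlaneArch (k : ℤ) ≤ 1 / (2 * Real.cos (3 * Real.pi / 8)) := by
  classical
  -- the coded sums `A d N` of the trapezoid `S_{N+1,N+1}`
  obtain ⟨A, hA⟩ : ∃ A : ℤ → ℕ → ℝ, ∀ d N, A d N = ∑ P ∈ (midWalks (stripV (N + 1) (N + 1))).filter
      (fun P => finalDart P = ((d, 0, false), (d, -1, true)) ∨
        finalDart P = ((d, -1, true), (d, 0, false))), hexCriticalFugacity ^ mwLen P :=
    ⟨_, fun _ _ => rfl⟩
  have hGA : ∀ d, halfPlaneArch d = ⨆ N, A d N := fun d => by simp only [hA]; rfl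
  have hA0 : ∀ d N, 0 ≤ A d N := fun d N => by rw [hA]; exact codedArchSum_nonneg d N
  have hAmono : ∀ d, Monotone (A d) := fun d N R h => by rw [hA, hA]; exact hvArchSum_mono d h
  have hAneg : ∀ d N, A (-d) N = A d N := fun d N => by
    rw [hA, hA]; exact stub_codedArchSum_reflect N d
  have hAtot : ∀ N : ℕ, ∑ d ∈ (Finset.Icc (-((N : ℤ) + 1)) ((N : ℤ) + 1)).erase 0, A d N ≤
      (Real.cos (3 * Real.pi / 8))⁻¹ := fun N => by simp only [hA]; exact archTotal_le N
  have hpos : ∀ k ∈ S, 0 < k := fun k hk => Nat.pos_of_ne_zero fun h => hS (h ▸ hk)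
  -- the flux bound for the coded sums
  have key : ∀ N : ℕ, 2 * ∑ k ∈ S, A k N ≤ (Real.cos (3 * Real.pi / 8))⁻¹ := by
    intro N
    obtain ⟨R, hNR, hSR⟩ : ∃ R : ℕ, N ≤ R ∧ ∀ k ∈ S, k ≤ R :=
      ⟨max N (S.sup id), le_max_left _ _, fun k hk =>
        (Finset.le_sup (f := id) hk).trans (le_max_right _ _)⟩
    have hinj₁ : Set.InjOn (fun k : ℕ => (k : ℤ)) S := fun a _ b _ h => by simpa using h
    have hinj₂ : Set.InjOn (fun k : ℕ => -(k : ℤ)) S := fun a _ b _ h => by simpa using h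
    have hdisj : Disjoint (S.image fun k : ℕ => (k : ℤ)) (S.image fun k : ℕ => -(k : ℤ)) := by
      rw [Finset.disjoint_left]
      intro x h₁ h₂
      obtain ⟨k, hk, rfl⟩ := Finset.mem_image.1 h₁
      obtain ⟨k', hk', h⟩ := Finset.mem_image.1 h₂
      have := hpos k hk
      omega
    have hsub : (S.image fun k : ℕ => (k : ℤ)) ∪ (S.image fun k : ℕ => -(k : ℤ)) ⊆
        (Finset.Icc (-((R : ℤ) + 1)) ((R : ℤ) + 1)).erase 0 := by
      intro x hx
      rw [mem_offsetWindow_iff]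
      rcases Finset.mem_union.1 hx with hx | hx <;> obtain ⟨k, hk, rfl⟩ := Finset.mem_image.1 hx <;>
        have h1 := hpos k hk <;> have h2 := hSR k hk
      · exact ⟨by omega, by rw [Nat.abs_cast]; omega⟩
      · exact ⟨by omega, by rw [abs_neg, Nat.abs_cast]; omega⟩
    calc 2 * ∑ k ∈ S, A k N = ∑ k ∈ S, A k N + ∑ k ∈ S, A k N := two_mul _
      _ ≤ ∑ k ∈ S, A k R + ∑ k ∈ S, A (-(k : ℤ)) R := by
          gcongr with k hk k hk
          · exact hAmono _ hNR
          · rw [hAneg]; exact hAmono _ hNR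
      _ = ∑ d ∈ (S.image fun k : ℕ => (k : ℤ)) ∪ (S.image fun k : ℕ => -(k : ℤ)), A d R := by
          rw [Finset.sum_union hdisj, Finset.sum_image hinj₁, Finset.sum_image hinj₂]
      _ ≤ ∑ d ∈ (Finset.Icc (-((R : ℤ) + 1)) ((R : ℤ) + 1)).erase 0, A d R :=
          Finset.sum_le_sum_of_subset_of_nonneg hsub fun d _ _ => hA0 d R
      _ ≤ _ := hAtot R
  -- pass to the supremum
  have hbdd : ∀ k ∈ S, BddAbove (Set.range (A k)) := fun k hk =>
    ⟨(Real.cos (3 * Real.pi / 8))⁻¹, by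
      rintro _ ⟨N, rfl⟩
      have h1 : A k N ≤ ∑ k ∈ S, A k N :=
        Finset.single_le_sum (f := fun k : ℕ => A k N) (fun k _ => hA0 k N) hk
      linarith [key N, hA0 k N]⟩
  have hlim : Tendsto (fun N => 2 * ∑ k ∈ S, A k N) atTop (𝓝 (2 * ∑ k ∈ S, halfPlaneArch (k : ℤ))) := by
    refine Tendsto.const_mul 2 (tendsto_finsetSum S fun k hk => ?_)
    rw [hGA]
    exact tendsto_atTop_ciSup (hAmono k) (hbdd k hk)
  have h2 : 2 * ∑ k ∈ S, halfPlaneArch (k : ℤ) ≤ (Real.cos (3 * Real.pi / 8))⁻¹ :=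
    le_of_tendsto' hlim key
  have hc : Real.cos (3 * Real.pi / 8) ≠ 0 := cos_three_pi_div_eight_pos.ne'
  have h3 : (Real.cos (3 * Real.pi / 8))⁻¹ = 2 * (1 / (2 * Real.cos (3 * Real.pi / 8))) := by
    field_simp
  linarith

/-! ### The Gram form at the Fejér test vector -/

/-- Reflection `j ↦ n - j` of `range n` onto `[1, n]`. [folklore] -/
theorem sum_range_reflect_Ico (f : ℕ → ℝ) (n : ℕ) :
    ∑ j ∈ Finset.range n, f (n - j) = ∑ m ∈ Finset.Ico 1 (n + 1), f m := by
  refine Finset.sum_nbij' (fun j => n - j) (fun m => n - m) ?_ ?_ ?_ ?_ (fun _ _ => rfl) <;>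
    intro a ha <;> simp only [Finset.mem_range, Finset.mem_Ico] at ha ⊢ <;> omega

/-- **Counting lemma** for the kernel `a` on the diagonal, `f(|j - k|)` off it:
`Σ_{j,k<n} = n·a + 2·Σ_{1 ≤ m < n} (n - m)·f(m)` (there are `n - m` pairs at distance `m` on each
side of the diagonal). [folklore] -/
theorem sum_sum_kern (a : ℝ) (f : ℕ → ℝ) (n : ℕ) :
    ∑ j ∈ Finset.range n, ∑ k ∈ Finset.range n,
        (if j = k then a else if j < k then f (k - j) else f (j - k)) =
      n * a + 2 * ∑ m ∈ Finset.Ico 1 n, ((n : ℝ) - m) * f m := by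
  induction n with
  | zero => simp
  | succ n ih =>
    simp only [Finset.sum_range_succ, if_true]
    rw [Finset.sum_add_distrib, ih]
    have h1 : ∑ j ∈ Finset.range n, (if j = n then a else if j < n then f (n - j) else f (j - n)) =
        ∑ m ∈ Finset.Ico 1 (n + 1), f m := by
      rw [← sum_range_reflect_Ico f n]
      refine Finset.sum_congr rfl fun j hj => ?_
      rw [if_neg (Finset.mem_range.1 hj).ne, if_pos (Finset.mem_range.1 hj)]
    have h2 : ∑ k ∈ Finset.range n, (if n = k then a else if n < k then f (k - n) else f (n - k)) =
        ∑ m ∈ Finset.Ico 1 (n + 1), f m := by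
      rw [← sum_range_reflect_Ico f n]
      refine Finset.sum_congr rfl fun k hk => ?_
      rw [if_neg (Finset.mem_range.1 hk).ne', if_neg (not_lt.2 (Finset.mem_range.1 hk).le)]
    rw [h1, h2]
    rcases Nat.eq_zero_or_pos n with rfl | hn
    · simp
    have hn1 : 1 ≤ n := hn
    have h3 : ∑ m ∈ Finset.Ico 1 (n + 1), (((n + 1 : ℕ) : ℝ) - m) * f m =
        ∑ m ∈ Finset.Ico 1 n, ((n : ℝ) - m) * f m + ∑ m ∈ Finset.Ico 1 (n + 1), f m := by
      rw [Finset.sum_Ico_succ_top hn1 (fun m => (((n + 1 : ℕ) : ℝ) - m) * f m),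
        Finset.sum_Ico_succ_top hn1 f, ← add_assoc, ← Finset.sum_add_distrib]
      congr 1
      · refine Finset.sum_congr rfl fun m _ => ?_
        push_cast
        ring
      · push_cast
        ring
    rw [h3]
    push_cast
    ring

/-- **Entrywise real part** of the Gram form at the Fejér vector `e^{iqj}`: `1` on the diagonal and
`G(|j-k|)·cos(q|j-k| + 5π/8)` off it. [folklore] -/
theorem re_entry (G : ℕ → ℝ) (q : ℝ) (j k : ℕ) :
    ((starRingEnd ℂ) (Complex.exp ((q * j : ℝ) * Complex.I)) * Complex.exp ((q * k : ℝ) * Complex.I) *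
      (if j = k then 1 else Complex.exp (Complex.I * (5 * Real.pi / 8) * (if j < k then 1 else -1)) *
        (G (Int.natAbs ((j : ℤ) - k)) : ℂ))).re =
      if j = k then 1 else if j < k then G (k - j) * Real.cos (q * (k - j : ℕ) + 5 * Real.pi / 8)
        else G (j - k) * Real.cos (q * (j - k : ℕ) + 5 * Real.pi / 8) := by
  have hconj : (starRingEnd ℂ) (Complex.exp ((q * j : ℝ) * Complex.I)) =
      Complex.exp ((-(q * j) : ℝ) * Complex.I) := by
    rw [← Complex.exp_conj, map_mul, Complex.conj_ofReal, Complex.conj_I, mul_neg,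
      Complex.ofReal_neg, neg_mul]
  rw [hconj]
  split_ifs with hjk hlt
  · subst hjk
    rw [mul_one, ← Complex.exp_add, Complex.ofReal_neg, neg_mul, neg_add_cancel, Complex.exp_zero,
      Complex.one_re]
  · have hnat : Int.natAbs ((j : ℤ) - k) = k - j := by omega
    rw [hnat, mul_one]
    have e : Complex.exp ((-(q * j) : ℝ) * Complex.I) * Complex.exp ((q * k : ℝ) * Complex.I) *
        (Complex.exp (Complex.I * (5 * Real.pi / 8)) * (G (k - j) : ℂ)) =
        Complex.exp ((q * ((k - j : ℕ) : ℝ) + 5 * Real.pi / 8 : ℝ) * Complex.I) * (G (k - j) : ℂ) := by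
      rw [← mul_assoc, ← Complex.exp_add, ← Complex.exp_add]
      congr 2
      push_cast [Nat.cast_sub hlt.le]
      ring
    rw [e, Complex.re_mul_ofReal, Complex.exp_ofReal_mul_I_re, mul_comm]
  · have hkj : k < j := lt_of_le_of_ne (not_lt.1 hlt) (Ne.symm hjk)
    have hnat : Int.natAbs ((j : ℤ) - k) = j - k := by omega
    rw [hnat, mul_neg_one]
    have e : Complex.exp ((-(q * j) : ℝ) * Complex.I) * Complex.exp ((q * k : ℝ) * Complex.I) *
        (Complex.exp (-(Complex.I * (5 * Real.pi / 8))) * (G (j - k) : ℂ)) =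
        Complex.exp ((-(q * ((j - k : ℕ) : ℝ) + 5 * Real.pi / 8) : ℝ) * Complex.I) * (G (j - k) : ℂ) := by
      rw [← mul_assoc, ← Complex.exp_add, ← Complex.exp_add]
      congr 2
      push_cast [Nat.cast_sub hkj.le]
      ring
    rw [e, Complex.re_mul_ofReal, Complex.exp_ofReal_mul_I_re, Real.cos_neg, mul_comm]

/-- **The Gram form at the Fejér vector**: its real part is
`n + 2·Σ_{1 ≤ m < n} (n - m)·G(m)·cos(qm + 5π/8)`. [folklore] -/
theorem gram_re (G : ℕ → ℝ) (q : ℝ) (n : ℕ) :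
    (∑ j : Fin n, ∑ k : Fin n, (starRingEnd ℂ) (Complex.exp ((q * (j : ℕ) : ℝ) * Complex.I)) *
        Complex.exp ((q * (k : ℕ) : ℝ) * Complex.I) *
        (if (j : ℕ) = k then 1 else Complex.exp (Complex.I * (5 * Real.pi / 8) * (if (j : ℕ) < k then 1 else -1)) *
          (G (Int.natAbs ((j : ℤ) - k)) : ℂ))).re =
      n + 2 * ∑ m ∈ Finset.Ico 1 n, ((n : ℝ) - m) * (G m * Real.cos (q * m + 5 * Real.pi / 8)) := by
  -- the real kernel
  obtain ⟨T, hT⟩ : ∃ T : ℕ → ℕ → ℝ, ∀ j k, T j k = if j = k then (1 : ℝ) else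
      if j < k then G (k - j) * Real.cos (q * (k - j : ℕ) + 5 * Real.pi / 8)
      else G (j - k) * Real.cos (q * (j - k : ℕ) + 5 * Real.pi / 8) := ⟨_, fun _ _ => rfl⟩
  rw [Complex.re_sum]
  have inner : ∀ j : Fin n, (∑ k : Fin n, (starRingEnd ℂ) (Complex.exp ((q * (j : ℕ) : ℝ) * Complex.I)) *
      Complex.exp ((q * (k : ℕ) : ℝ) * Complex.I) *
      (if (j : ℕ) = k then 1 else Complex.exp (Complex.I * (5 * Real.pi / 8) * (if (j : ℕ) < k then 1 else -1)) *
        (G (Int.natAbs ((j : ℤ) - k)) : ℂ))).re = ∑ k ∈ Finset.range n, T j k := by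
    intro j
    rw [Complex.re_sum]
    exact (Fintype.sum_congr _ _ fun k : Fin n => (re_entry G q j k).trans (hT j k).symm).trans
      (Fin.sum_univ_eq_sum_range (T j) n)
  rw [Finset.sum_congr rfl fun j _ => inner j,
    Fin.sum_univ_eq_sum_range (fun j => ∑ k ∈ Finset.range n, T j k) n]
  simp only [hT]
  rw [sum_sum_kern 1 (fun m => G m * Real.cos (q * m + 5 * Real.pi / 8)) n, mul_one]

/-! ### The real-analysis step -/

/-- **Abstract Bochner–Fejér step.**  If `G ≥ 0` has partial sums `≤ B`, `φ = -W ≤ 1`, `W M = c`,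
`c·B = 1/2`, and `0 ≤ n + 2·Σ_{1 ≤ m < n} (n - m)·G(m)·φ(m)` for every `n`, then
`Σ_{1 ≤ k < M} G(k)·(W k - c) ≤ (1 + c)·(B - Σ_{k=1}^{M} G(k))` (split at `M`, divide by `n`,
`n → ∞`). [folklore] -/
theorem abstract_ineq (G W φ : ℕ → ℝ) (c B : ℝ) {M : ℕ} (hM : 1 ≤ M)
    (hG0 : ∀ m, 0 ≤ G m) (hflux : ∀ n : ℕ, ∑ m ∈ Finset.Ico 1 n, G m ≤ B)
    (hφW : ∀ m, φ m = -W m) (hφ1 : ∀ m, φ m ≤ 1) (hWM : W M = c) (hcB : c * B = 1 / 2)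
    (hstar : ∀ n : ℕ, 0 ≤ (n : ℝ) + 2 * ∑ m ∈ Finset.Ico 1 n, ((n : ℝ) - m) * (G m * φ m)) :
    ∑ k ∈ Finset.Ico 1 M, G k * (W k - c) ≤ (1 + c) * (B - ∑ k ∈ Finset.Ico 1 (M + 1), G k) := by
  -- Step 1: for `n > M`, `n·A - C ≤ n·(1/2 + B - S)`
  have step1 : ∀ n : ℕ, M < n →
      (n : ℝ) * (∑ m ∈ Finset.Ico 1 (M + 1), G m * W m) -
          ∑ m ∈ Finset.Ico 1 (M + 1), (m : ℝ) * (G m * W m) ≤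
        n * (1 / 2 + (B - ∑ m ∈ Finset.Ico 1 (M + 1), G m)) := by
    intro n hn
    have h1 : 1 ≤ M + 1 := Nat.succ_le_succ (Nat.zero_le M)
    have h2 : M + 1 ≤ n := hn
    have h := hstar n
    rw [← Finset.sum_Ico_consecutive _ h1 h2] at h
    have hfirst : ∑ m ∈ Finset.Ico 1 (M + 1), ((n : ℝ) - m) * (G m * φ m) =
        -((n : ℝ) * (∑ m ∈ Finset.Ico 1 (M + 1), G m * W m) -
          ∑ m ∈ Finset.Ico 1 (M + 1), (m : ℝ) * (G m * W m)) := by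
      rw [Finset.mul_sum, ← Finset.sum_sub_distrib, ← Finset.sum_neg_distrib]
      refine Finset.sum_congr rfl fun m _ => ?_
      rw [hφW]
      ring
    have htail : ∑ m ∈ Finset.Ico (M + 1) n, G m ≤ B - ∑ m ∈ Finset.Ico 1 (M + 1), G m := by
      have := hflux n
      rw [← Finset.sum_Ico_consecutive _ h1 h2] at this
      linarith
    have hsecond : ∑ m ∈ Finset.Ico (M + 1) n, ((n : ℝ) - m) * (G m * φ m) ≤
        n * (B - ∑ m ∈ Finset.Ico 1 (M + 1), G m) := by
      calc ∑ m ∈ Finset.Ico (M + 1) n, ((n : ℝ) - m) * (G m * φ m)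
          ≤ ∑ m ∈ Finset.Ico (M + 1) n, (n : ℝ) * G m := by
            refine Finset.sum_le_sum fun m hm => ?_
            have hmn : (m : ℝ) ≤ n := by exact_mod_cast (Finset.mem_Ico.1 hm).2.le
            have hGm := hG0 m
            have h3 : 0 ≤ ((n : ℝ) - m) * G m := mul_nonneg (sub_nonneg.2 hmn) hGm
            have h4 : ((n : ℝ) - m) * G m * φ m ≤ ((n : ℝ) - m) * G m * 1 :=
              mul_le_mul_of_nonneg_left (hφ1 m) h3
            have h5 : 0 ≤ (m : ℝ) * G m := mul_nonneg (Nat.cast_nonneg m) hGm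
            linarith
        _ = n * ∑ m ∈ Finset.Ico (M + 1) n, G m := (Finset.mul_sum _ _ _).symm
        _ ≤ n * (B - ∑ m ∈ Finset.Ico 1 (M + 1), G m) :=
            mul_le_mul_of_nonneg_left htail (Nat.cast_nonneg n)
    rw [hfirst] at h
    linarith
  -- Step 2: let `n → ∞`
  have step2 : ∑ m ∈ Finset.Ico 1 (M + 1), G m * W m ≤
      1 / 2 + (B - ∑ m ∈ Finset.Ico 1 (M + 1), G m) := by
    obtain ⟨A, hA⟩ : ∃ A : ℝ, A = ∑ m ∈ Finset.Ico 1 (M + 1), G m * W m := ⟨_, rfl⟩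
    obtain ⟨C, hC⟩ : ∃ C : ℝ, C = ∑ m ∈ Finset.Ico 1 (M + 1), (m : ℝ) * (G m * W m) := ⟨_, rfl⟩
    obtain ⟨R, hR⟩ : ∃ R : ℝ, R = 1 / 2 + (B - ∑ m ∈ Finset.Ico 1 (M + 1), G m) := ⟨_, rfl⟩
    rw [← hA, ← hC, ← hR] at step1
    rw [← hA, ← hR]
    have hlim : Tendsto (fun n : ℕ => A - C / (n : ℝ)) atTop (𝓝 A) := by
      simpa using tendsto_const_nhds.sub (tendsto_const_div_atTop_nhds_zero_nat C)
    refine le_of_tendsto hlim ?_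
    filter_upwards [eventually_gt_atTop M] with n hn
    have hn0 : (0 : ℝ) < n := by exact_mod_cast (Nat.zero_le M).trans_lt hn
    have h := step1 n hn
    have e : A - C / (n : ℝ) = ((n : ℝ) * A - C) / n := by
      field_simp
    rw [e, div_le_iff₀ hn0]
    linarith
  -- Step 3: algebra (`W M = c`, `c·B = 1/2`)
  have hsplit : ∑ k ∈ Finset.Ico 1 (M + 1), G k * (W k - c) =
      ∑ k ∈ Finset.Ico 1 M, G k * (W k - c) := by
    rw [Finset.sum_Ico_succ_top hM, hWM, sub_self, mul_zero, add_zero]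
  have hexp : ∑ k ∈ Finset.Ico 1 (M + 1), G k * (W k - c) =
      ∑ k ∈ Finset.Ico 1 (M + 1), G k * W k - c * ∑ k ∈ Finset.Ico 1 (M + 1), G k := by
    rw [Finset.mul_sum, ← Finset.sum_sub_distrib]
    exact Finset.sum_congr rfl fun k _ => by ring
  rw [← hsplit, hexp]
  linarith

/-- **Concrete Bochner–Fejér step** for `q = 3π/(4M)`: the phase identity
`cos(qm + 5π/8) = -cos((3π/8)(2m/M - 1))`, `cos ≤ 1`, `cos((3π/8)(2M/M - 1)) = cos(3π/8)` and
`cos(3π/8)·(1/(2cos(3π/8))) = 1/2` feed `abstract_ineq`. [folklore] -/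
theorem concrete_ineq (G : ℕ → ℝ) (hG0 : ∀ m, 0 ≤ G m)
    (hflux : ∀ n : ℕ, ∑ m ∈ Finset.Ico 1 n, G m ≤ 1 / (2 * Real.cos (3 * Real.pi / 8)))
    {M : ℕ} (hM : 1 ≤ M)
    (hstar : ∀ n : ℕ, 0 ≤ (n : ℝ) + 2 * ∑ m ∈ Finset.Ico 1 n,
      ((n : ℝ) - m) * (G m * Real.cos (3 * Real.pi / (4 * M) * m + 5 * Real.pi / 8))) :
    ∑ k ∈ Finset.Ico 1 M, G k *
        (Real.cos (3 * Real.pi / 8 * (2 * (k : ℝ) / M - 1)) - Real.cos (3 * Real.pi / 8)) ≤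
      (1 + Real.cos (3 * Real.pi / 8)) *
        (1 / (2 * Real.cos (3 * Real.pi / 8)) - ∑ k ∈ Finset.Icc 1 M, G k) := by
  have hc : Real.cos (3 * Real.pi / 8) ≠ 0 := cos_three_pi_div_eight_pos.ne'
  have hMne : (M : ℝ) ≠ 0 := by
    have : (0 : ℝ) < M := by exact_mod_cast hM
    exact this.ne'
  rw [← Finset.Ico_add_one_right_eq_Icc]
  refine abstract_ineq G (fun k => Real.cos (3 * Real.pi / 8 * (2 * (k : ℝ) / M - 1)))
    (fun m => Real.cos (3 * Real.pi / (4 * M) * m + 5 * Real.pi / 8)) (Real.cos (3 * Real.pi / 8))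
    (1 / (2 * Real.cos (3 * Real.pi / 8))) hM hG0 hflux ?_ (fun m => Real.cos_le_one _) ?_ ?_ hstar
  · intro m
    show Real.cos (3 * Real.pi / (4 * M) * m + 5 * Real.pi / 8) =
      -Real.cos (3 * Real.pi / 8 * (2 * (m : ℝ) / M - 1))
    rw [← Real.cos_add_pi]
    congr 1
    field_simp
    ring
  · show Real.cos (3 * Real.pi / 8 * (2 * (M : ℝ) / M - 1)) = Real.cos (3 * Real.pi / 8)
    congr 1
    field_simp
    ring
  · field_simp

end BochnerIneq

/-- **Registered sub-goal `stub_bochnerIneq_of_positivity`** (crux item stmt-CriticalPhenomena-0808, line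
`root-locality-replaces-loewner`, s3's STUB 2 `HalfPlaneGramPositivity → HalfPlaneBochnerIneq`):
positive semi-definiteness of the twisted half-plane boundary Gram matrix
`K_{jk} = 1 (j = k), e^{±5πi/8}·G(|j - k|)` implies, for every `M ≥ 1`, the Bochner tail inequality
`Σ_{1 ≤ k < M} G(k)·(cos((3π/8)(2k/M - 1)) - cos(3π/8)) ≤ (1 + cos(3π/8))·(1/(2cos(3π/8)) - Σ_{k=1}^{M} G(k))`
— test the form against the Fejér vector `e^{iqj}`, `q = 3π/(4M)`, use the flux bound
`Σ_{1 ≤ k < n} G(k) ≤ 1/(2cos(3π/8))` and let `n → ∞`.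
[cite: KrachunPanagiotis2026, Definition 2.4 (G_k); DuminilCopinSmirnov2012, Lemma 2 and §3 ("A_T ≤ 1/c_α")] -/
theorem stub_bochnerIneq_of_positivity : (∀ (n : ℕ) (c : Fin n → ℂ), 0 ≤ (∑ j : Fin n, ∑ k : Fin n, (starRingEnd ℂ) (c j) * c k * (if (j : ℕ) = k then 1 else Complex.exp (Complex.I * (5 * Real.pi / 8) * (if (j : ℕ) < k then 1 else -1)) * (Summit.CriticalPhenomena.SAWScalingLimit.Theorems.HexConjecture.RootLocality.halfPlaneArch ((Int.natAbs ((j : ℤ) - k) : ℕ) : ℤ) : ℂ))).re) → (∀ M : ℕ, 1 ≤ M → ∑ k ∈ Finset.Ico 1 M, Summit.CriticalPhenomena.SAWScalingLimit.Theorems.HexConjecture.RootLocality.halfPlaneArch ((k : ℕ) : ℤ) * (Real.cos (3 * Real.pi / 8 * (2 * (k : ℝ) / M - 1)) - Real.cos (3 * Real.pi / 8)) ≤ (1 + Real.cos (3 * Real.pi / 8)) * (1 / (2 * Real.cos (3 * Real.pi / 8)) - ∑ k ∈ Finset.Icc 1 M, Summit.CriticalPhenomena.SAWScalingLimit.Theorems.HexConjecture.RootLocality.halfPlaneArch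 ((k : ℕ) : ℤ))) := by
  intro hpos M hM
  have hstar : ∀ n : ℕ, 0 ≤ (n : ℝ) + 2 * ∑ m ∈ Finset.Ico 1 n, ((n : ℝ) - m) *
      (halfPlaneArch (m : ℤ) * Real.cos (3 * Real.pi / (4 * M) * m + 5 * Real.pi / 8)) := by
    intro n
    rw [← BochnerIneq.gram_re (fun m : ℕ => halfPlaneArch (m : ℤ)) (3 * Real.pi / (4 * M)) n]
    exact hpos n _
  exact BochnerIneq.concrete_ineq (fun m => halfPlaneArch (m : ℤ))
    (fun m => BochnerIneq.halfPlaneArch_nonneg _)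
    (fun n => BochnerIneq.sum_halfPlaneArch_le _ (by simp)) hM hstar

end Summit.CriticalPhenomena.SAWScalingLimit.Theorems.HexConjecture.RootLocality

end
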